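import Literature.AlgebraicGeometry.Frobenioids.PadicFrobenioidSplittingMonoid
import Literature.AlgebraicGeometry.Frobenioids.PadicFrobenioidThm12TypesProofs
import Literature.AlgebraicGeometry.Frobenioids.CharacteristicSplitting
import HarnessLib

/-!
# Frobenioids II, Theorem 1.2 (v): the characteristic splitting determined by `p` on a `p`-adic Frobenioid

Mochizuki, *The geometry of Frobenioids II*, Kyushu J. Math. **62** (2008) 401–460, §1, Theorem 1.2 (v),
p. 9, with its proof p. 10 [cite: MochizukiFrdII2008, Thm 1.2 (v) pp.9-10]:

> "(v) Suppose that `Φ` is absolutely primitive. Then `C` is of base-trivial type. Moreover, the element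
> `p ∈ ℚ_p^×` determines a characteristic splitting [cf. [FrdI], Definition 2.3] on `C`."
> Proof (p. 10): "… it is immediate that the image of `p ∈ ℚ_p^×` in `K^×` [for `Spec(K) ∈ Ob(D₀)`]
> determines a characteristic splitting."

This file DISCHARGES the second clause in the tree's vocabulary for [FrdI] Def. 2.3 (abc-iut-L1-t2's
`PreFrobenioid.CharacteristicSplitting`, `CharacteristicSplitting.lean`), closing the TODO-merge of the
`Thm12Vocab.IsCharacteristicSplitting` slot of `PadicFrobenioidThm12.lean` (abc-iut-L1-t4; RQ7 note N1),
over the monoid `τ_p(A)` of `PadicFrobenioidSplittingMonoid.lean`: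

* `exists_divZeroHom_resK_unit_eq`, `exists_mem_pSplittingSubmonoid_associated` — for absolutely primitive
  `Φ`, every `e ∈ O^▷(A)` has `u_e|_{K^×} = p^m · y` with `m ∈ ℕ` and `y ∈ O_{K_A}^×` (negative exponents
  are excluded since `Φ₀(A) = ord(O_K^⊳) ⊗ ℝ_{≥0}` is sharp), so `τ_p(A) → O^▷(A)^char` is surjective
  (the unit part lifts to `O^×(A) ≅ O_{K_A}^×`, abc-iut-L1-d10's `ker_divZeroHom_eq_unitSubgroup`);
* `Datum.pSplitting hap : CharacteristicSplitting d.structureFunctor` — **the characteristic splitting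
  determined by `p`**, all conditions of [FrdI] Def. 2.3 PROVED;
* `Thm12Vocab.bindSplitting V` — the vocabulary record with its characteristic-splitting slot BOUND to
  t2's structure (`τ` is a characteristic splitting iff it is the `τ`-component of one), the other slots
  unchanged; `Datum.thm12_v_bindSplitting` — **Theorem 1.2 (v) holds for every so-bound vocabulary**
  (first clause: abc-iut-L1-d10's `thm12_isBaseTrivial_of_isAbsolutelyPrimitive`).

No statement of the paper is strengthened: the splitting is the printed one ("the image of `p` in
`K^×`"); the model-type / rationally-standard / Frobenius-functor slots of `Thm12Vocab` are left as they
are (their owners' constructions are pending).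
-/

noncomputable section

namespace Literature.AlgebraicGeometry.Frobenioids

namespace PadicFrd

open CategoryTheory Opposite Function ValuativeRel

universe v u

namespace Datum

variable {D : Type u} [Category.{v} D] {p : ℕ} [Fact p.Prime] (d : Datum D p)

/-- For absolutely primitive `Φ`, the rational function of an element of `O^▷(A)` has the divisor of a
NONNEGATIVE power of `p`: `Div₀(u_e|_{K^×}) = Div₀(p^m)` with `m ∈ ℕ` (negative exponents are excluded
because `Φ₀(A) = ord(O_K^⊳) ⊗ ℝ_{≥0}` is sharp and `ord(p) ≠ 0`). [cite: MochizukiFrdII2008, Thm 1.2 (v) p.10] -/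
theorem exists_divZeroHom_resK_unit_eq (hap : d.IsAbsolutelyPrimitive) {X : d.frobenioid} {e : X ⟶ X}
    (he : e ∈ PreFrobenioid.endSubmonoid d.structureFunctor X) :
    ∃ m : ℕ, divZeroHom (d.fld X.base) (d.resK X.base (ModelFrobenioid.unit e)) =
      divZeroHom (d.fld X.base) (d.primeUnit X.base ^ m) := by
  obtain ⟨⟨inst, hfin, hc⟩⟩ := d.isPadicLocal X.base
  letI := inst
  haveI := hfin
  haveI := isCancelMul_realification (OrdInt (d.fld X.base))
  -- `Div₀(u_e|_{K^×}) = ι^gp(Div e)` (cartesian square + relation (d))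
  have hsq := d.divZeroHom_resK X.base (ModelFrobenioid.unit e)
  rw [← d.of_div_eq_divB_unit he, MonGp.map_of] at hsq
  -- absolute primitivity: `ι^gp(Div e) = k · ord(p)` with `k ∈ ℤ`
  have hmem : MonGp.map (d.ιHom X.base) (Algebra.GrothendieckGroup.of (ModelFrobenioid.div e)) ∈
      Subgroup.zpowers (d.ordIntGp X.base (Associates.mk ⟨((p : ℕ) : d.fld X.base), (d.base.obj X.base).p_mem⟩)) :=
    d.mem_zpowers_of_isAbsolutelyPrimitive hap X.base _
  rw [MonGp.map_of] at hmem
  obtain ⟨k, hk⟩ := Subgroup.mem_zpowers_iff.mp hmem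
  set rp : Realification (OrdInt (d.fld X.base)) := Realification.of (OrdInt (d.fld X.base))
    (Associates.mk ⟨((p : ℕ) : d.fld X.base), (d.base.obj X.base).p_mem⟩) with hrp
  have hgen : d.ordIntGp X.base (Associates.mk ⟨((p : ℕ) : d.fld X.base), (d.base.obj X.base).p_mem⟩) =
      Algebra.GrothendieckGroup.of rp := rfl
  -- the exponent is nonnegative
  have hk0 : 0 ≤ k := by
    by_contra hneg
    rw [not_le] at hneg
    obtain ⟨m, hm⟩ := Int.exists_eq_neg_ofNat hneg.le
    have hm0 : m ≠ 0 := by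
      rintro rfl
      simp only [Nat.cast_zero, neg_zero] at hm
      omega
    rw [hm, hgen, zpow_neg, zpow_natCast, ← map_pow, inv_eq_iff_mul_eq_one, mul_comm, ← map_mul] at hk
    have h1 : d.ιHom X.base (ModelFrobenioid.div e) * rp ^ m = 1 :=
      Algebra.GrothendieckGroup.of_injective (hk.trans (map_one _).symm)
    have hmono : IsMonoprime (OrdInt (d.fld X.base)) := isMonoprime_ordInt hc
    have hsharp : IsSharp (Realification (OrdInt (d.fld X.base))) :=
      (IsMonoprime.ofR (isRMonoprime_realification hmono)).isSharp
    have hunit : IsUnit rp := (isUnit_pow_iff hm0).mp (IsUnit.of_mul_eq_one_right _ h1)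
    have hrp1 : rp = 1 := hsharp.1 rp hunit
    have h2 : Associates.mk (⟨((p : ℕ) : d.fld X.base), (d.base.obj X.base).p_mem⟩ :
        intNonzero (d.fld X.base)) = 1 :=
      Realification.of_injective hmono (hrp1.trans (map_one _).symm)
    rw [Associates.mk_eq_one] at h2
    exact (d.base.obj X.base).p_lt.ne ((isUnit_intNonzero_iff (d.fld X.base) _).mp h2)
  obtain ⟨m, rfl⟩ := Int.eq_ofNat_of_zero_le hk0
  refine ⟨m, ?_⟩
  rw [map_pow, d.divZeroHom_primeUnit, ← zpow_natCast, hk]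
  exact hsq

/-- **`τ_p(A) → O^▷(A)^char` is surjective** for absolutely primitive `Φ`: every `e ∈ O^▷(A)` is
`t · w` with `t ∈ τ_p(A)` and `w ∈ O^×(A)` — write `u_e|_{K^×} = p^m · y` with `y ∈ O_K^×`, lift `y` to a
unit `w = (1, id, 0, u_w)` of `A` and put `t := (1, id, Div e, u_e · u_w⁻¹)`.
[cite: MochizukiFrdII2008, Thm 1.2 (v) p.10] -/
theorem exists_mem_pSplittingSubmonoid_associated (hap : d.IsAbsolutelyPrimitive) {X : d.frobenioid}
    {e : End X} (he : e ∈ PreFrobenioid.endSubmonoid d.structureFunctor X) :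
    ∃ (t : End X) (ht : t ∈ d.pSplittingSubmonoid X),
      Associated (⟨t, ht.1⟩ : PreFrobenioid.endSubmonoid d.structureFunctor X) ⟨e, he⟩ := by
  obtain ⟨⟨inst, hfin, hc⟩⟩ := d.isPadicLocal X.base
  letI := inst
  haveI := hfin
  have heE : End.asHom e ∈ PreFrobenioid.endSubmonoid d.structureFunctor X := he
  obtain ⟨m, hm⟩ := d.exists_divZeroHom_resK_unit_eq hap heE
  -- the unit part `y := u_e|_{K^×} · p^{-m} ∈ O_K^×`
  set y : (d.fld X.base)ˣ := d.resK X.base (ModelFrobenioid.unit (End.asHom e)) * (d.primeUnit X.base ^ m)⁻¹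
    with hy
  have hyU : y ∈ unitSubgroup (d.fld X.base) := by
    rw [← ker_divZeroHom_eq_unitSubgroup hc, MonoidHom.mem_ker, hy, map_mul, map_inv, hm, mul_inv_cancel]
  obtain ⟨uw, huw₁, huw₂⟩ := d.exists_B_over_unit (op X.base) y hyU
  obtain ⟨cw, rfl⟩ := d.isUnit_B (op X.base) uw
  have huw₁' : d.resK X.base (cw : d.B.obj (op X.base)) = y := huw₁
  -- the unit `w = (1, id, 0, u_w)` of `A`, its inverse `w'`, and `t := (1, id, Div e, u_e · u_w⁻¹)`
  have hw₁ : Algebra.GrothendieckGroup.of (1 : d.Φ.obj (op X.base)) =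
      Frobenioids.divB d.Φ d.B d.divB (op X.base) (cw : d.B.obj (op X.base)) := by rw [map_one, huw₂]
  have hcw' : Frobenioids.divB d.Φ d.B d.divB (op X.base) ((cw⁻¹ : (d.B.obj (op X.base))ˣ) : _) = 1 := by
    have h : Frobenioids.divB d.Φ d.B d.divB (op X.base) ((cw⁻¹ : (d.B.obj (op X.base))ˣ) : _) =
        (Frobenioids.divB d.Φ d.B d.divB (op X.base) (cw : _))⁻¹ :=
      eq_inv_of_mul_eq_one_right (by rw [← map_mul, Units.mul_inv, map_one])
    rw [h, huw₂, inv_one]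
  have hw₂ : Algebra.GrothendieckGroup.of (1 : d.Φ.obj (op X.base)) =
      Frobenioids.divB d.Φ d.B d.divB (op X.base) ((cw⁻¹ : (d.B.obj (op X.base))ˣ) : _) := by
    rw [map_one, hcw']
  have ht₀ : Algebra.GrothendieckGroup.of (ModelFrobenioid.div (End.asHom e)) =
      Frobenioids.divB d.Φ d.B d.divB (op X.base)
        (ModelFrobenioid.unit (End.asHom e) * ((cw⁻¹ : (d.B.obj (op X.base))ˣ) : _)) := by
    rw [map_mul, hcw', mul_one]
    exact d.of_div_eq_divB_unit heE
  let w : X ⟶ X := ModelFrobenioid.unitEnd X 1 (cw : d.B.obj (op X.base)) hw₁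
  let w' : X ⟶ X := ModelFrobenioid.unitEnd X 1 ((cw⁻¹ : (d.B.obj (op X.base))ˣ) : _) hw₂
  let t : X ⟶ X := ModelFrobenioid.unitEnd X (ModelFrobenioid.div (End.asHom e))
    (ModelFrobenioid.unit (End.asHom e) * ((cw⁻¹ : (d.B.obj (op X.base))ˣ) : _)) ht₀
  have hwm : End.of w ∈ PreFrobenioid.endSubmonoid d.structureFunctor X := d.unitEnd_mem_endSubmonoid X _ _ _
  have hw'm : End.of w' ∈ PreFrobenioid.endSubmonoid d.structureFunctor X := d.unitEnd_mem_endSubmonoid X _ _ _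
  have htm : End.of t ∈ PreFrobenioid.endSubmonoid d.structureFunctor X := d.unitEnd_mem_endSubmonoid X _ _ _
  -- `u_t|_{K^×} = p^m`
  have hinv : d.resK X.base ((cw⁻¹ : (d.B.obj (op X.base))ˣ) : _) = y⁻¹ := by
    rw [← huw₁', ← Units.coe_map, ← Units.coe_map, map_inv, Units.val_inv_eq_inv_val]
  have htK : d.resK X.base (ModelFrobenioid.unit (End.asHom (End.of t))) = d.primeUnit X.base ^ m := by
    change d.resK X.base (ModelFrobenioid.unit (End.asHom e) * ((cw⁻¹ : (d.B.obj (op X.base))ˣ) : _)) = _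
    rw [map_mul, hinv, hy, mul_inv_rev, inv_inv, mul_comm (d.primeUnit X.base ^ m), mul_inv_cancel_left]
  -- `w` is a unit of the monoid `O^▷(A)` with inverse `w'`
  have hww' : (⟨End.of w, hwm⟩ : PreFrobenioid.endSubmonoid d.structureFunctor X) * ⟨End.of w', hw'm⟩ = 1 := by
    apply Subtype.ext
    change w' ≫ w = 𝟙 X
    refine ModelFrobenioid.hom_ext ?_ ?_ ?_ ?_
    · exact mul_one _
    · exact Category.id_comp _
    · change (d.Φ.map (𝟙 X.base).op).hom 1 * 1 ^ ((1 : ℕ+) : ℕ) = 1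
      rw [map_one, one_pow, mul_one]
    · change (d.B.map (𝟙 X.base).op).hom (cw : d.B.obj (op X.base)) *
        ((cw⁻¹ : (d.B.obj (op X.base))ˣ) : _) ^ ((1 : ℕ+) : ℕ) = 1
      rw [ModelFrobenioid.map_id_apply_B, PNat.one_coe, pow_one, Units.mul_inv]
  have hw'w : (⟨End.of w', hw'm⟩ : PreFrobenioid.endSubmonoid d.structureFunctor X) * ⟨End.of w, hwm⟩ = 1 := by
    apply Subtype.ext
    change w ≫ w' = 𝟙 X
    refine ModelFrobenioid.hom_ext ?_ ?_ ?_ ?_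
    · exact mul_one _
    · exact Category.id_comp _
    · change (d.Φ.map (𝟙 X.base).op).hom 1 * 1 ^ ((1 : ℕ+) : ℕ) = 1
      rw [map_one, one_pow, mul_one]
    · change (d.B.map (𝟙 X.base).op).hom ((cw⁻¹ : (d.B.obj (op X.base))ˣ) : _) *
        (cw : d.B.obj (op X.base)) ^ ((1 : ℕ+) : ℕ) = 1
      rw [ModelFrobenioid.map_id_apply_B, PNat.one_coe, pow_one, Units.inv_mul]
  let W : (PreFrobenioid.endSubmonoid d.structureFunctor X)ˣ := ⟨⟨End.of w, hwm⟩, ⟨End.of w', hw'm⟩, hww', hw'w⟩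
  refine ⟨End.of t, ⟨htm, m, htK⟩, W, Subtype.ext ?_⟩
  -- `t · w = e`, i.e. `w ≫ t = e`
  change w ≫ t = End.asHom e
  have h1 : ModelFrobenioid.degFr (End.asHom e) = 1 := he.2
  have h2 : ModelFrobenioid.baseMap (End.asHom e) = 𝟙 X.base := he.1
  refine ModelFrobenioid.hom_ext ?_ ?_ ?_ ?_
  · rw [h1]
    exact mul_one _
  · rw [h2]
    exact Category.id_comp _
  · change (d.Φ.map (𝟙 X.base).op).hom (ModelFrobenioid.div (End.asHom e)) * 1 ^ ((1 : ℕ+) : ℕ) =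
      ModelFrobenioid.div (End.asHom e)
    rw [ModelFrobenioid.map_id_apply_Φ, one_pow, mul_one]
  · change (d.B.map (𝟙 X.base).op).hom
        (ModelFrobenioid.unit (End.asHom e) * ((cw⁻¹ : (d.B.obj (op X.base))ˣ) : _)) *
        (cw : d.B.obj (op X.base)) ^ ((1 : ℕ+) : ℕ) = ModelFrobenioid.unit (End.asHom e)
    rw [ModelFrobenioid.map_id_apply_B, PNat.one_coe, pow_one, Units.inv_mul_cancel_right]

/-- **Theorem 1.2 (v), second clause** (FrdII p. 9): for absolutely primitive `Φ`, "the element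
`p ∈ ℚ_p^×` determines a characteristic splitting on `C`" — the splitting `A ↦ τ_p(A)` IS a characteristic
splitting in the sense of [FrdI] Def. 2.3 (abc-iut-L1-t2's `PreFrobenioid.CharacteristicSplitting`), all
conditions PROVED. [cite: MochizukiFrdII2008, Thm 1.2 (v) p.9] -/
def pSplitting (hap : d.IsAbsolutelyPrimitive) : PreFrobenioid.CharacteristicSplitting d.structureFunctor where
  τ := d.pSplittingSubmonoid
  τ_le := fun {X} _ => d.pSplittingSubmonoid_le X
  res_mem := fun {_ _} _ _ φ hφ _ hβ _ hα h => d.mem_pSplittingSubmonoid_of_comp_eq φ hφ hβ hα h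
  bijective := fun {X} _ => by
    constructor
    · rintro ⟨t, ht⟩ ⟨t', ht'⟩ h
      exact Subtype.ext (d.eq_of_associated ht ht' (Associates.mk_eq_mk_iff_associated.mp h))
    · intro q
      obtain ⟨e, rfl⟩ := Associates.mk_surjective q
      obtain ⟨t, ht, hte⟩ := d.exists_mem_pSplittingSubmonoid_associated hap e.2
      exact ⟨⟨t, ht⟩, Associates.mk_eq_mk_iff_associated.mpr hte⟩
  hull := fun {_ _} φ hφ _ hβ => d.exists_comp_eq_of_isLinear φ hφ.2.1.1 hβ

/-- The `τ`-component of `pSplitting` is `pSplittingSubmonoid`. [cite: MochizukiFrdII2008, Thm 1.2 (v) p.9] -/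
@[simp] theorem pSplitting_τ (hap : d.IsAbsolutelyPrimitive) : (d.pSplitting hap).τ = d.pSplittingSubmonoid :=
  rfl

end Datum

/-! ### Binding the characteristic-splitting slot of `Thm12Vocab`; Theorem 1.2 (v) -/

variable {D : Type u} [Category.{v} D] {p : ℕ} [Fact p.Prime] {d : Datum D p}

/-- The vocabulary record `V` with its characteristic-splitting slot BOUND to [FrdI] Def. 2.3 as typed by
abc-iut-L1-t2: `τ` "is a characteristic splitting on `C`" iff `τ` is the family of submonoids of a
`PreFrobenioid.CharacteristicSplitting d.structureFunctor`. The remaining slots (model type, rationally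
standard type, Frobenius functors) are those of `V`. [cite: MochizukiFrdII2008, Thm 1.2 (v) p.9] -/
def Thm12Vocab.bindSplitting (V : Thm12Vocab d) : Thm12Vocab d where
  IsOfModelType := V.IsOfModelType
  IsOfRationallyStandardType := V.IsOfRationallyStandardType
  IsCharacteristicSplitting τ := ∃ T : PreFrobenioid.CharacteristicSplitting d.structureFunctor, T.τ = τ
  AdmitsUnitLinearFrobeniusFunctors := V.AdmitsUnitLinearFrobeniusFunctors
  AdmitsUnitwiseFrobeniusFunctorsI := V.AdmitsUnitwiseFrobeniusFunctorsI
  AdmitsUnitwiseFrobeniusFunctorsII := V.AdmitsUnitwiseFrobeniusFunctorsII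

/-- The bound slot, unfolded. [cite: MochizukiFrdII2008, Thm 1.2 (v) p.9] -/
theorem Thm12Vocab.bindSplitting_isCharacteristicSplitting (V : Thm12Vocab d)
    (τ : ∀ A : d.frobenioid, Submonoid (End A)) :
    (V.bindSplitting).IsCharacteristicSplitting τ ↔
      ∃ T : PreFrobenioid.CharacteristicSplitting d.structureFunctor, T.τ = τ :=
  Iff.rfl

namespace Datum

variable (d)

/-- **Theorem 1.2 (v)** (FrdII p. 9) for the `p`-adic Frobenioid, with the characteristic-splitting notion
BOUND to [FrdI] Def. 2.3: "Suppose that `Φ` is absolutely primitive. Then `C` is of base-trivial type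
[abc-iut-L1-d10]. Moreover, the element `p ∈ ℚ_p^×` determines a characteristic splitting on `C`" —
PROVED (`Datum.pSplitting`). [cite: MochizukiFrdII2008, Thm 1.2 (v) p.9] -/
theorem thm12_v_bindSplitting (V : Thm12Vocab d) : Thm12_v d V.bindSplitting :=
  d.thm12_v_of V.bindSplitting fun hap =>
    ⟨d.pSplittingSubmonoid, ⟨d.pSplitting hap, rfl⟩, fun X _ hf => (d.pSplittingSubmonoid_le X) hf⟩

end Datum

end PadicFrd

end Literature.AlgebraicGeometry.Frobenioids
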